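import Summits.HodgeConjecture.HodgeConjecture.Theorems.Ring2HypothesesDescentMotivatedStandardA
import Summits.HodgeConjecture.HodgeConjecture.Theorems.Ring2HypothesesDescentStandardBDischarged
import Summits.HodgeConjecture.HodgeConjecture.Theorems.Ring2AbelianAllLefschetzPencilsGraded
import Summits.HodgeConjecture.HodgeConjecture.Theorems.Ring2AbelianAllLefschetzPencilsRungs
import HarnessLib

/-!
# Ring 2 — hypotheses layer, descent axis: binder row b05 on the standard-conjecture side, II — the GRADED rows:
# the `A`-form and the motivated form of the transport node per relative dimension, the doubling row to `HC` in
# dimension `g`, the Weil column at `d = 4`; and the parent binder's sandwich made FACT-FREE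

HONEST FRAMING (page 1, verbatim the cell's standing line): **research route conditional on HC_CM; not a
corollary; Q11.4-sentence-2 already refuted in dim ≥ 3.** Nothing in this file proves a case of the Hodge
conjecture; `HC_CM` (= `Theses.RankFourFaces.CMAbelianHodge`, a BINDER of the cell, by name only, never restated)
enters exactly the rows labelled KIND 2 as a displayed hypothesis, nowhere as a conclusion; every OPEN node
(`StandardACMPointedPencilsAtRelDim d`, `CMAnchoredTransportAtRelDim d`, `CMPowerAnchoredCompactWeilPencilsAt 2`, the
motivated inclusions) is a displayed hypothesis; the printed theorems `h₈A` (Abdulali 1994 p. 1122 with the Lefschetz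
hypothesis AS PRINTED), `h₂₁` (André Lemme 6.3.1) are named facts displayed as binders.

Sequel of `Ring2HypothesesDescentMotivatedStandardA` (seat ring2-b05 gen 2, `BINDER-OWNERS.md` row b05
`Ring2.Hypotheses.MotivatedImpliesAlgebraicAV`; parent `MotivatedImpliesAlgebraic`). That part proved, per variety,
`A_motᵖ(X)_ℂ ⊆ Nᵖ H²ᵖ` for `2 ≤ p < n/2` ⟹ Grothendieck's `A(X, η)`, and the blanket consequences (parent ⟹ `A(all)`,
parent ⟹ `X_A` ⟹ row b05, `(A∀)_4 ⟸ A_mot² ⊆ N² H⁴` on fivefold pencil totals). Here, GRADED by the relative dimension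
`d` of the compact abelian pencils (seat ab-andre-2's `Ring2.AbelianAll.CMAnchoredTransportAtRelDim d`, seat
ab-andre-1's `(A^CM)_d = StandardACMPointedPencilsAtRelDim d`, `(A∀)_d`, the class targets `HCAtDim g`):

* §1 THE SANDWICH, FACT-FREE: `B⋆(all) ⟹ MotivatedImpliesAlgebraic ⟹ A(all)` with André's §2.1 binder `hBA`
  DISCHARGED by part XXXV (`motivatedImpliesAlgebraic_of_standardConjectureB_discharged`, typer2) — the parent binder
  of row b05 (= row b10's consequence) sits between the two printed forms of the Lefschetz standard conjecture
  with NO named fact on either side (`motivatedImpliesAlgebraic_between_standardConjectures_factFree`).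
* §2 GRADED `A`-FORM TRANSPORT (the glue; the blanket rows are ab-andre-1 XIV-b, the graded `⋆_L`-rows are part
  VII — the graded `A`-row was absent): `(A^CM)_d ∧ h₈A ⟹ CMAnchoredTransportAtRelDim d`, `(A∀)_d ∧ h₈A ⟹` the same.
* §3 GRADED MOTIVATED ROWS: "motivated ⟹ algebraic below the middle on the `(d+1)`-fold total spaces of the
  CM-pointed compact pencils of abelian `d`-folds" `∧ h₈A ⟹ CMAnchoredTransportAtRelDim d`; with the doubling of
  Lemme 6.3.1 (ab-andre-2 `hcAtDim_of_HC_CM_of_cmAnchoredTransportAtRelDim`), KIND 2: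
  `HC_CM ∧ h₈A ∧ h₂₁ ∧ [A_motᵖ ⊆ Nᵖ H²ᵖ, 2 ≤ p ≤ g, on the (2g+1)-fold CM-pointed pencil totals] ⟹ HCAtDim g` —
  for the abelian FOURFOLDS (`g = 4`, the first open dimension) the motivated input sits on NINE-dimensional total
  spaces in codimensions `2, 3, 4`.
* §4 THE WEIL COLUMN AT `d = 4`, `HC_CM`-FREE (consistency row; the conclusion is Markman's theorem in print):
  `(W_E)₂ ∧ h₈A ∧ (A^CM)_4 ⟹` every Weil class on every abelian fourfold of Weil type is algebraic
  (`Markman2025_weilClasses_algebraic_abelianFourfold`), hence `(W_E)₂ ∧ h₈A ∧ [A_mot²(𝒳)_ℂ ⊆ N² H⁴(𝒳) on the FIVEFOLD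
  total spaces of the CM-pointed compact pencils of abelian fourfolds] ⟹` the same — the single `η`-free
  codimension-`2` motivated inclusion on fivefolds reads the Weil classes of fourfolds, through Abdulali's transport
  in print's letter and the `E`-power Weil habitat (ab-andre-1/2 part IX), without `HC_CM` and without André 0.6.2.
* §5 one ledger conjunction.

Discharge status of row b05: UNCHANGED (OPEN; «10 · 0»). Seat boundaries: the nodes `CMAnchoredTransportAtRelDim`,
`StandardAC[MPointed|ompact]PencilsAtRelDim`, `CMPowerAnchoredCompactWeilPencilsAt`, `HCAtDim` and the rows
`hcAtDim_of_HC_CM_of_cmAnchoredTransportAtRelDim`, `markman2025Fourfold_of_cmPowerWeilPencilsAt_two_of_cmAnchoredTransportAtRelDim_four`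
are seats ab-andre-1/2's and are IMPORTED BY NAME (count once); new here are only the `A`-form/motivated antecedents.

References (bib keys): Andre1996Motifs (§2.1 p. 14; Lemme 6.3.1, Lemme 6.3.3, §6.3 a) and Remarque 2, pp. 31–33),
Grothendieck1968 (§3 p. 196), Abdulali1994FamiliesAV (p. 1122, Lemma 6.2 p. 1131), Milne2020HodgeClassesAV (Prop. 1,
Thm. 4), Markman2025SurveySecant (Thm. 1.2), vanGeemen1994HodgeAV (Thm. 4.3, 5.2–5.12), VoisinHodgeI2002 (Thm. 6.25).
-/

set_option linter.dupNamespace false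

noncomputable section

open CategoryTheory
open Literature.AlgebraicGeometry Literature.AlgebraicGeometry.Motives
open Literature.AlgebraicGeometry.HodgeTheory
open Literature.AlgebraicGeometry.Abdulali1994 (Abdulali1994_invariantCycles_of_lefschetzStandardA)
open Literature.AlgebraicGeometry.Andre1996 (andre1996_cmAnchoredPencil)
open Literature.AlgebraicGeometry.Deligne1982 (cmLocus)
open Summit.HodgeConjecture.HodgeConjecture.Ring2.ClassTargets (HCAtDim HCUpToDim)
open Summit.HodgeConjecture.HodgeConjecture.Ring2.AbelianAll (StandardACompactPencilsAtRelDim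
  StandardACMPointedPencilsAtRelDim CMAnchoredTransportAtRelDim CMPowerAnchoredCompactWeilPencilsAt
  standardACMPointedPencilsAtRelDim_of_compact hcAtDim_of_HC_CM_of_cmAnchoredTransportAtRelDim
  hcUpToDim_of_HC_CM_of_cmAnchoredTransportAtRelDim
  markman2025Fourfold_of_cmPowerWeilPencilsAt_two_of_cmAnchoredTransportAtRelDim_four)

namespace Summit.HodgeConjecture.HodgeConjecture.Ring2.Hypotheses

/-! ## §1 The parent binder between `B⋆(all)` and `A(all)`, fact-free -/

/-- **`B⋆(all) ⟹ MotivatedImpliesAlgebraic ⟹ A(all)`, NO named fact**: the first arrow is part XXXV's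
`motivatedImpliesAlgebraic_of_standardConjectureB_discharged` (André §2.1 remark, the binder `hBA` of part III fed by
the tree theorem `Theorems.Andre1996_motivatedClasses_le_algebraicClasses_of_standardConjectureB_holds`), the second is
part I of this pair (`forall_standardConjectureA_of_motivatedImpliesAlgebraic`). The parent binder of row b05 is thus
kernel-sandwiched between Grothendieck's `B(X)` (`⋆_L`-form, all smooth projective `X`, all `η`) and `A(X, η)` (all
`X`, all polarisation classes); print closes the circle by `A(X × X) ⟹ B(X)` (not in the tree, not claimed).
[cite: Andre1996Motifs, §2.1 remark following Déf. 1 (p. 14)] [cite: Grothendieck1968, §3 p. 196 (A(X), B(X))] -/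
theorem motivatedImpliesAlgebraic_between_standardConjectures_factFree :
    ((∀ (d : ℕ) (Z : SchemeOver ℂ) (η : complexBetti Z 2), IsSmoothProjective d Z →
        StandardConjectureBStar d Z η) → MotivatedImpliesAlgebraic) ∧
      (MotivatedImpliesAlgebraic → ∀ ⦃n : ℕ⦄ ⦃X : SchemeOver ℂ⦄ (η : complexBetti X 2),
        IsSmoothProjective n X → IsPolarizationClass n X η → StandardConjectureA n X η) :=
  ⟨motivatedImpliesAlgebraic_of_standardConjectureB_discharged,
    forall_standardConjectureA_of_motivatedImpliesAlgebraic⟩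

/-! ## §2 Graded `A`-form transport: `(A^CM)_d ∧ h₈A ⟹ CMAnchoredTransportAtRelDim d` -/

/-- **`(A^CM)_d ⟹ CMAnchoredTransportAtRelDim d`, granted Abdulali p. 1122 with the hypothesis as printed (`h₈A`)**:
on a CM-pointed compact pencil of abelian `d`-folds, `A(𝒳, η)` for every polarisation class of the total space gives
transport of algebraicity along the pencil (`h₈A`, one pencil at a time), in particular from the CM fibre. The graded
`A`-letter twin of part VII's `cmAnchoredTransportAtRelDim_of_abdulali_of_lefschetzBCMPointedPencilsAtRelDim` (`⋆_L`-form,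
`h₈`) and of XIV-b's blanket `cmFibreTransport_of_abdulaliA_of_cmPointedPencilStandardA`.
[cite: Abdulali1994FamiliesAV, p. 1122 and Lemma 6.2 (p. 1131)] [cite: Milne2020HodgeClassesAV, Prop. 1 (p. 7)]
[cite: Andre1996Motifs, §6.3 a) (p. 33)] -/
theorem cmAnchoredTransportAtRelDim_of_abdulaliA_of_standardACMPointedPencilsAtRelDim
    (h₈A : Abdulali1994_invariantCycles_of_lefschetzStandardA) {d : ℕ} (hA : StandardACMPointedPencilsAtRelDim d) :
    CMAnchoredTransportAtRelDim d :=
  fun _ _ f hf p W hW t ht h₀ s ↦ h₈A f hf (hA f hf ⟨t, ht⟩) p W hW ⟨t, h₀⟩ s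

/-- `(A∀)_d ⟹ CMAnchoredTransportAtRelDim d`, granted `h₈A`. [cite: Abdulali1994FamiliesAV, p. 1122]
[cite: Milne2020HodgeClassesAV, Prop. 1 (p. 7)] -/
theorem cmAnchoredTransportAtRelDim_of_abdulaliA_of_standardACompactPencilsAtRelDim
    (h₈A : Abdulali1994_invariantCycles_of_lefschetzStandardA) {d : ℕ} (hA : StandardACompactPencilsAtRelDim d) :
    CMAnchoredTransportAtRelDim d :=
  cmAnchoredTransportAtRelDim_of_abdulaliA_of_standardACMPointedPencilsAtRelDim h₈A
    (standardACMPointedPencilsAtRelDim_of_compact hA)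

/-- **KIND 2, graded, `A`-letter: `HC_CM ∧ (A^CM)_{2g} ⟹ HCAtDim g`**, granted `h₈A` and Lemme 6.3.1 (`h₂₁`): the Hodge
conjecture for complex abelian `g`-folds from `HC_CM` and Grothendieck's `A(𝒳, η)` on the `(2g+1)`-dimensional total
spaces of the CM-pointed compact pencils of abelian `2g`-folds (the pencil of Lemme 6.3.1 through `A` has fibres
isogenous to `A × A`: ab-andre-2's doubling row `hcAtDim_of_HC_CM_of_cmAnchoredTransportAtRelDim`, imported).
research route conditional on HC_CM; not a corollary. [cite: Andre1996Motifs, Lemme 6.3.1 (p. 31) and §6.3 a) (p. 33)]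
[cite: Abdulali1994FamiliesAV, p. 1122] [cite: Milne2020HodgeClassesAV, Prop. 1 and Thm. 4] -/
theorem hcAtDim_of_HC_CM_of_abdulaliA_of_standardACMPointedPencilsAtRelDim_double
    (h₈A : Abdulali1994_invariantCycles_of_lefschetzStandardA) (h₂₁ : andre1996_cmAnchoredPencil)
    (hCM : Theses.RankFourFaces.CMAbelianHodge) (g : ℕ) (hA : StandardACMPointedPencilsAtRelDim (2 * g)) :
    HCAtDim g :=
  hcAtDim_of_HC_CM_of_cmAnchoredTransportAtRelDim h₂₁ hCM g
    (cmAnchoredTransportAtRelDim_of_abdulaliA_of_standardACMPointedPencilsAtRelDim h₈A hA)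

/-! ## §3 Graded motivated rows -/

/-- **"Motivated ⟹ algebraic below the middle" on the CM-pointed pencil total spaces of relative dimension `d` gives
`CMAnchoredTransportAtRelDim d`, granted `h₈A`**: if for every CM-pointed compact pencil `f : 𝒳 ⟶ S` of abelian
`d`-folds and every `2 ≤ p`, `2p < d + 1`, `A_motᵖ(𝒳)_ℂ ⊆ Nᵖ H²ᵖ(𝒳(ℂ); ℂ)`, then (part I,
`standardConjectureA_of_motivatedClasses_le_algebraicClasses`) `(A^CM)_d` holds, and §2 applies. No `HC_CM`.
[cite: Andre1996Motifs, §2.1 (p. 14) and §6.3 a) (p. 33)] [cite: Abdulali1994FamiliesAV, p. 1122] -/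
theorem cmAnchoredTransportAtRelDim_of_abdulaliA_of_motivatedClasses_le_cmPointedTotal
    (h₈A : Abdulali1994_invariantCycles_of_lefschetzStandardA) {d : ℕ}
    (h : ∀ ⦃𝒳 S : SchemeOver ℂ⦄ (f : 𝒳 ⟶ S), IsCompactAbelianPencil f d → (cmLocus f d).Nonempty →
      ∀ p : ℕ, 2 ≤ p → 2 * p < d + 1 → motivatedClasses (d + 1) 𝒳 p ≤ algebraicClasses 𝒳 p) :
    CMAnchoredTransportAtRelDim d :=
  cmAnchoredTransportAtRelDim_of_abdulaliA_of_standardACMPointedPencilsAtRelDim h₈A fun _ _ f hf hCM _ hη ↦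
    standardConjectureA_of_motivatedClasses_le_algebraicClasses hf.isSmoothProjective_total hη (h f hf hCM)

/-- **KIND 2, graded, motivated letter: `HC_CM ∧ h₈A ∧ h₂₁ ∧ [A_mot ⊆ A below the middle on the (2g+1)-fold
CM-pointed pencil totals] ⟹ HCAtDim g`.** The motivated input is asked in the codimensions `2 ≤ p ≤ g` of the
`(2g+1)`-dimensional total spaces of the CM-pointed compact pencils of abelian `2g`-folds. research route conditional
on HC_CM; not a corollary. [cite: Andre1996Motifs, Lemme 6.3.1 (p. 31), §2.1 (p. 14) and §6.3 a) (p. 33)]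
[cite: Abdulali1994FamiliesAV, p. 1122] -/
theorem hcAtDim_of_HC_CM_of_abdulaliA_of_motivatedClasses_le_cmPointedTotal_double
    (h₈A : Abdulali1994_invariantCycles_of_lefschetzStandardA) (h₂₁ : andre1996_cmAnchoredPencil)
    (hCM : Theses.RankFourFaces.CMAbelianHodge) (g : ℕ)
    (h : ∀ ⦃𝒳 S : SchemeOver ℂ⦄ (f : 𝒳 ⟶ S), IsCompactAbelianPencil f (2 * g) → (cmLocus f (2 * g)).Nonempty →
      ∀ p : ℕ, 2 ≤ p → 2 * p < 2 * g + 1 → motivatedClasses (2 * g + 1) 𝒳 p ≤ algebraicClasses 𝒳 p) :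
    HCAtDim g :=
  hcAtDim_of_HC_CM_of_cmAnchoredTransportAtRelDim h₂₁ hCM g
    (cmAnchoredTransportAtRelDim_of_abdulaliA_of_motivatedClasses_le_cmPointedTotal h₈A h)

/-- **The `g = 4` row (abelian FOURFOLDS, the first open dimension of `HC`):** `HC_CM ∧ h₈A ∧ h₂₁ ∧ [A_motᵖ(𝒳)_ℂ ⊆
Nᵖ H²ᵖ(𝒳), p = 2, 3, 4, on the NINE-dimensional total spaces 𝒳 of the CM-pointed compact pencils of abelian
eightfolds] ⟹ HCAtDim 4`. Compare part VII's `hcAtDim_four_of_HC_CM_of_abdulali_of_lefschetzBCMPointedPencilsAtRelDim_eight`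
(`⋆_L`-form `B` on the same ninefolds, `h₈`). research route conditional on HC_CM; not a corollary.
[cite: Andre1996Motifs, Lemme 6.3.1 (p. 31) and Remarque 2 (p. 33)] [cite: Abdulali1994FamiliesAV, p. 1122] -/
theorem hcAtDim_four_of_HC_CM_of_abdulaliA_of_motivatedClasses_le_cmPointedTotal_eight
    (h₈A : Abdulali1994_invariantCycles_of_lefschetzStandardA) (h₂₁ : andre1996_cmAnchoredPencil)
    (hCM : Theses.RankFourFaces.CMAbelianHodge)
    (h : ∀ ⦃𝒳 S : SchemeOver ℂ⦄ (f : 𝒳 ⟶ S), IsCompactAbelianPencil f 8 → (cmLocus f 8).Nonempty →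
      ∀ p : ℕ, 2 ≤ p → p ≤ 4 → motivatedClasses 9 𝒳 p ≤ algebraicClasses 𝒳 p) :
    HCAtDim 4 :=
  hcAtDim_of_HC_CM_of_abdulaliA_of_motivatedClasses_le_cmPointedTotal_double h₈A h₂₁ hCM 4
    fun _ _ f hf hCM' p hp hp' ↦ h f hf hCM' p hp (by omega)

/-- **All dimensions `≤ g`**: `HC_CM ∧ h₈A ∧ h₂₁ ∧ [motivated ⟹ algebraic below the middle on the CM-pointed pencil
totals of every EVEN relative dimension `2g' ≤ 2g`] ⟹ HCUpToDim g` (the graded node is not known to be monotone in the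
relative dimension, so the input is asked at each `2g'`). research route conditional on HC_CM; not a corollary.
[cite: Andre1996Motifs, §6.3 a) (p. 33)] [cite: Abdulali1994FamiliesAV, p. 1122] -/
theorem hcUpToDim_of_HC_CM_of_abdulaliA_of_motivatedClasses_le_cmPointedTotal
    (h₈A : Abdulali1994_invariantCycles_of_lefschetzStandardA) (h₂₁ : andre1996_cmAnchoredPencil)
    (hCM : Theses.RankFourFaces.CMAbelianHodge) (g : ℕ)
    (h : ∀ g' ≤ g, ∀ ⦃𝒳 S : SchemeOver ℂ⦄ (f : 𝒳 ⟶ S), IsCompactAbelianPencil f (2 * g') →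
      (cmLocus f (2 * g')).Nonempty → ∀ p : ℕ, 2 ≤ p → 2 * p < 2 * g' + 1 →
        motivatedClasses (2 * g' + 1) 𝒳 p ≤ algebraicClasses 𝒳 p) :
    HCUpToDim g :=
  hcUpToDim_of_HC_CM_of_cmAnchoredTransportAtRelDim h₂₁ hCM g fun g' hg' ↦
    cmAnchoredTransportAtRelDim_of_abdulaliA_of_motivatedClasses_le_cmPointedTotal h₈A (h g' hg')

/-! ## §4 The Weil column at relative dimension `4`, `HC_CM`-free -/

/-- **`(W_E)₂ ∧ h₈A ∧ (A^CM)_4 ⟹` the Weil classes on abelian fourfolds of Weil type are algebraic**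
(`Markman2025_weilClasses_algebraic_abelianFourfold` — Markman's THEOREM in print, here a CONCLUSION; a CONSISTENCY row,
NO `HC_CM`, NO André 0.6.2): Grothendieck's `A(𝒳, η)` on the FIVEFOLD total spaces of the CM-pointed compact pencils of
abelian fourfolds gives transport at relative dimension `4` (§2) — the first relative dimension where transport is not a
theorem of the tree — and on the `E`-power Weil habitat `(W_E)₂` (ab-andre part IX, a displayed hypothesis) transport
from the CM fibre reads every Weil class (`markman2025Fourfold_of_cmPowerWeilPencilsAt_two_of_cmAnchoredTransportAtRelDim_four`,
imported). The `A`-letter twin of part IX's `markman2025Fourfold_of_abdulali_of_cmPowerWeilPencilsAt_two_of_lefschetzBCMPointedPencilsAtRelDim_four`.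
[cite: Markman2025SurveySecant, Thm. 1.2] [cite: Abdulali1994FamiliesAV, p. 1122] [cite: vanGeemen1994HodgeAV, Thm. 4.3]
[cite: Andre1996Motifs, Lemme 6.3.3 (p. 33)] -/
theorem markman2025Fourfold_of_abdulaliA_of_cmPowerWeilPencilsAt_two_of_standardACMPointedPencilsAtRelDim_four
    (h₈A : Abdulali1994_invariantCycles_of_lefschetzStandardA) (hW : CMPowerAnchoredCompactWeilPencilsAt 2)
    (hA : StandardACMPointedPencilsAtRelDim 4) : Markman2025_weilClasses_algebraic_abelianFourfold :=
  markman2025Fourfold_of_cmPowerWeilPencilsAt_two_of_cmAnchoredTransportAtRelDim_four hW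
    (cmAnchoredTransportAtRelDim_of_abdulaliA_of_standardACMPointedPencilsAtRelDim h₈A hA)

/-- **`(W_E)₂ ∧ h₈A ∧ [A_mot²(𝒳)_ℂ ⊆ N² H⁴(𝒳(ℂ); ℂ) on the FIVEFOLD total spaces of the CM-pointed compact pencils of
abelian fourfolds] ⟹` the Weil classes on abelian fourfolds of Weil type are algebraic.** The single, `η`-free,
codimension-`2` motivated inclusion on these fivefolds is the whole standard-conjecture input (part I:
`A(𝒳, η)` on a fivefold needs "onto" only at `(p, r) = (2, 1)`). CONSISTENCY row (conclusion = Markman's theorem in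
print); NO `HC_CM`, NO André 0.6.2; OPEN hypotheses displayed. [cite: Markman2025SurveySecant, Thm. 1.2]
[cite: Andre1996Motifs, §2.1 (p. 14) and Lemme 6.3.3 (p. 33)] [cite: Abdulali1994FamiliesAV, p. 1122]
[cite: Grothendieck1968, §3 p. 196 (A(X))] -/
theorem markman2025Fourfold_of_abdulaliA_of_cmPowerWeilPencilsAt_two_of_motivatedClasses_two_le_cmPointedTotal
    (h₈A : Abdulali1994_invariantCycles_of_lefschetzStandardA) (hW : CMPowerAnchoredCompactWeilPencilsAt 2)
    (h : ∀ ⦃𝒳 S : SchemeOver ℂ⦄ (f : 𝒳 ⟶ S), IsCompactAbelianPencil f 4 → (cmLocus f 4).Nonempty →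
      motivatedClasses 5 𝒳 2 ≤ algebraicClasses 𝒳 2) :
    Markman2025_weilClasses_algebraic_abelianFourfold :=
  markman2025Fourfold_of_cmPowerWeilPencilsAt_two_of_cmAnchoredTransportAtRelDim_four hW
    (cmAnchoredTransportAtRelDim_of_abdulaliA_of_motivatedClasses_le_cmPointedTotal h₈A
      fun _ _ f hf hCM p hp hp5 ↦ by
        obtain rfl : p = 2 := by omega
        exact h f hf hCM)

/-- **… in particular from the parent binder: `MotivatedImpliesAlgebraic ∧ (W_E)₂ ∧ h₈A ⟹` Markman's fourfold
statement** (consistency; no `HC_CM`). [cite: Markman2025SurveySecant, Thm. 1.2] [cite: Andre1996Motifs, §2.1 (p. 14)] -/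
theorem markman2025Fourfold_of_abdulaliA_of_cmPowerWeilPencilsAt_two_of_motivatedImpliesAlgebraic
    (h₈A : Abdulali1994_invariantCycles_of_lefschetzStandardA) (hW : CMPowerAnchoredCompactWeilPencilsAt 2)
    (h : MotivatedImpliesAlgebraic) : Markman2025_weilClasses_algebraic_abelianFourfold :=
  markman2025Fourfold_of_abdulaliA_of_cmPowerWeilPencilsAt_two_of_motivatedClasses_two_le_cmPointedTotal h₈A hW
    fun _ _ _ hf _ ↦ h hf.isSmoothProjective_total 2

/-! ## §5 The graded ledger -/

/-- **Row b05 on the standard-conjecture side, graded — one conjunction a referee can quote**: (i) the parent binder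
fact-free between `B⋆(all)` and `A(all)`; (ii) `(A^CM)_d ∧ h₈A ⟹` transport at relative dimension `d`; (iii) KIND 2:
`HC_CM ∧ h₈A ∧ h₂₁ ∧` motivated-below-the-middle on the `(2g+1)`-fold CM-pointed pencil totals `⟹ HCAtDim g`; (iv)
`HC_CM`-free Weil column: `(W_E)₂ ∧ h₈A ∧ A_mot² ⊆ N² H⁴` on the fivefold CM-pointed pencil totals `⟹` Markman's
fourfold statement. Nothing asserts `HC_CM`, `HC_AV`, row b05, its parent, or any node.
[cite: Andre1996Motifs, §2.1 (p. 14), Lemme 6.3.1 (p. 31), §6.3 a) and Remarque 2 (p. 33)]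
[cite: Abdulali1994FamiliesAV, p. 1122] [cite: Markman2025SurveySecant, Thm. 1.2] [cite: Grothendieck1968, §3 p. 196] -/
theorem b05_standardConjecture_graded_ledger
    (h₈A : Abdulali1994_invariantCycles_of_lefschetzStandardA) (h₂₁ : andre1996_cmAnchoredPencil) :
    (((∀ (d : ℕ) (Z : SchemeOver ℂ) (η : complexBetti Z 2), IsSmoothProjective d Z →
          StandardConjectureBStar d Z η) → MotivatedImpliesAlgebraic) ∧
        (MotivatedImpliesAlgebraic → ∀ ⦃n : ℕ⦄ ⦃X : SchemeOver ℂ⦄ (η : complexBetti X 2),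
          IsSmoothProjective n X → IsPolarizationClass n X η → StandardConjectureA n X η)) ∧
      (∀ d : ℕ, StandardACMPointedPencilsAtRelDim d → CMAnchoredTransportAtRelDim d) ∧
      (Theses.RankFourFaces.CMAbelianHodge → ∀ g : ℕ,
        (∀ ⦃𝒳 S : SchemeOver ℂ⦄ (f : 𝒳 ⟶ S), IsCompactAbelianPencil f (2 * g) → (cmLocus f (2 * g)).Nonempty →
          ∀ p : ℕ, 2 ≤ p → 2 * p < 2 * g + 1 → motivatedClasses (2 * g + 1) 𝒳 p ≤ algebraicClasses 𝒳 p) →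
        HCAtDim g) ∧
      (CMPowerAnchoredCompactWeilPencilsAt 2 →
        (∀ ⦃𝒳 S : SchemeOver ℂ⦄ (f : 𝒳 ⟶ S), IsCompactAbelianPencil f 4 → (cmLocus f 4).Nonempty →
          motivatedClasses 5 𝒳 2 ≤ algebraicClasses 𝒳 2) →
        Markman2025_weilClasses_algebraic_abelianFourfold) :=
  ⟨motivatedImpliesAlgebraic_between_standardConjectures_factFree,
    fun _ hA ↦ cmAnchoredTransportAtRelDim_of_abdulaliA_of_standardACMPointedPencilsAtRelDim h₈A hA,
    fun hCM g h ↦ hcAtDim_of_HC_CM_of_abdulaliA_of_motivatedClasses_le_cmPointedTotal_double h₈A h₂₁ hCM g h,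
    fun hW h ↦
      markman2025Fourfold_of_abdulaliA_of_cmPowerWeilPencilsAt_two_of_motivatedClasses_two_le_cmPointedTotal h₈A hW h⟩

end Summit.HodgeConjecture.HodgeConjecture.Ring2.Hypotheses

end
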